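import Summits.ValiantsHypothesis.ValiantsHypothesis.Theorems.SymPencilPerFourOneRowEndgame
import Summits.ValiantsHypothesis.ValiantsHypothesis.Theorems.SymPencilBasePointMoments
import Literature.Computability.AlgebraicComplexity.StandardFamilies

/-!
# Route `SymPencil` — the one-row kernel cell: from the base-point pencil identity to the
# identities (K0), (K1)  (`--supports` stmt-ValiantsHypothesis-5674; rung currency for
# `sdc(per_4)`, nothing here bears on `VP ≠ VNP`)

Abstract linear algebra over a field `K` of characteristic `0`.  DATA (the kernel package of a
symmetric affine determinantal representation of `per_4`, read at every base point of the kernel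
space; produced from a representation by `SymPencilPerFourBasePointPackage`): an invertible
symmetric `D` on `ι'`, linear families `bL` (kernel rows) and `CL` (symmetric blocks) on
`K^{4×4}`, `κ ≠ 0`, with the first origin moment `bᵀD⁻¹CD⁻¹b ≡ 0` and, for every `v` with
`bL v = 0`, invertibility of `D + CL v` together with the BASE-POINT PENCIL IDENTITY

  `κ · per_4 (v + s z) = det [[0, s bL(z)ᵀ], [s bL(z), D + CL v + s CL z]]`     (all `s, z`).

ONE-ROW HYPOTHESES: linear embeddings `embV : K⁴ → K^{4×4}` (the kernel row) and
`embX : K^{3×4} → K^{4×4}` (the other rows) with `bL ∘ embV = 0`, `bL ∘ embX` a bijection onto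
`im bL`, `per_4 (embV w + s · embX x) = s³ per [w; x]`, and the invariance
`CL(embV w) D⁻¹ (im bL) ⊆ im bL` (Lagrangian invariance, `SymPencilLagrangianInvariant`).

**Theorem** (`false_of_oneRow_embedding`): these data do not exist.  Proof: for `u = D⁻¹ bL(embX x)`
and the point `z_t = embX (x + t K(w) x)` with `bL (embX (K(w) x)) = CL(embV w) u` one has
`bL z_t = (D + CL(t·embV w)) u`, so the base-point identity at `v = t · embV w` and
`SymPencilBasePointMoments.basepoint_moment` give
`det (D + t CL(embV w)) · t · Θ(x)[K(w)x] = κ t · per [w; x + t K(w) x]`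
(`Θ(x)[y] = uᵀ CL(embX y) u`; the blocks of `CL` off the Lagrangian drop out); comparing the
`t⁰, t¹` coefficients yields (K0), (K1) of `SymPencilPerFourOneRowEndgame`, which are jointly
impossible (`false_of_oneRow_identities`). [folklore]
-/

noncomputable section

-- single-conjunct layout: Sub = Summit, duplicated namespace component intended
set_option linter.dupNamespace false

namespace Summit.ValiantsHypothesis.ValiantsHypothesis.Theorems.SymPencilPerFourOneRowKernel

open Matrix Module Polynomial MvPolynomial
open Literature.Computability.AlgebraicComplexity
open Summit.ValiantsHypothesis.ValiantsHypothesis.Theorems.SymPencilHomogeneousDropTools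
open Summit.ValiantsHypothesis.ValiantsHypothesis.Theorems.SymPencilLagrangianKernel
open Summit.ValiantsHypothesis.ValiantsHypothesis.Theorems.SymPencilBasePointMoments
open Summit.ValiantsHypothesis.ValiantsHypothesis.Theorems.SymPencilPerFourInnerRankRows
open Summit.ValiantsHypothesis.ValiantsHypothesis.Theorems.SymPencilPerFourOneRowEndgame

universe u

variable {K : Type u} [Field K]

/-- Homogeneity of `per [w; a; b; c]` in the row `w`. [folklore] -/
theorem permanent_rows_smul₀ (w a b c : Fin 4 → K) (t : K) :
    (Matrix.of ![t • w, a, b, c]).permanent = t * (Matrix.of ![w, a, b, c]).permanent := by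
  simp only [permanent_of_rows, Pi.smul_apply, smul_eq_mul]; ring

/-- Coefficients `0` and `1` of the cubic `C F₀ + C F₁ X + C F₂ X² + C F₃ X³`. [folklore] -/
theorem coeff_cubic (F₀ F₁ F₂ F₃ : K) :
    (Polynomial.C F₀ + Polynomial.C F₁ * Polynomial.X + Polynomial.C F₂ * Polynomial.X ^ 2 +
        Polynomial.C F₃ * Polynomial.X ^ 3).coeff 0 = F₀ ∧
    (Polynomial.C F₀ + Polynomial.C F₁ * Polynomial.X + Polynomial.C F₂ * Polynomial.X ^ 2 +
        Polynomial.C F₃ * Polynomial.X ^ 3).coeff 1 = F₁ := by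
  constructor <;> simp [Polynomial.coeff_C, Polynomial.coeff_X]

variable [CharZero K] {ι' : Type*} [Fintype ι'] [DecidableEq ι']

/-- **No one-row kernel.**  See the module docstring. [folklore] -/
theorem false_of_oneRow_embedding {D : Matrix ι' ι' K} (hD : IsUnit D.det) (hDs : Dᵀ = D)
    (bL : (Fin 4 × Fin 4 → K) →ₗ[K] (ι' → K))
    (CL : (Fin 4 × Fin 4 → K) →ₗ[K] Matrix ι' ι' K) (hCs : ∀ z, (CL z)ᵀ = CL z)
    {κ : K} (hκ : κ ≠ 0)
    (hii : ∀ z, bL z ⬝ᵥ (D⁻¹ * CL z * D⁻¹) *ᵥ bL z = 0)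
    (hN : ∀ v, bL v = 0 → IsUnit (D + CL v).det ∧ ∀ (z : Fin 4 × Fin 4 → K) (s : K),
      κ * MvPolynomial.eval (v + s • z) (perPoly (Fin 4) K) =
        (Matrix.fromBlocks ((s * 0) • (1 : Matrix Unit Unit K))
          (Matrix.replicateRow Unit (s • bL z)) (Matrix.replicateCol Unit (s • bL z))
          (D + CL v + s • CL z)).det)
    (embV : (Fin 4 → K) →ₗ[K] (Fin 4 × Fin 4 → K))
    (embX : (Fin 3 → Fin 4 → K) →ₗ[K] (Fin 4 × Fin 4 → K))
    (hEV : ∀ w, bL (embV w) = 0) (hEX : Function.Injective (bL ∘ₗ embX))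
    (hEXr : ∀ z, ∃ x, bL (embX x) = bL z)
    (hinv : ∀ (w : Fin 4 → K) (y : ι' → K), y ∈ LinearMap.range bL →
      CL (embV w) *ᵥ (D⁻¹ *ᵥ y) ∈ LinearMap.range bL)
    (hper : ∀ (w : Fin 4 → K) (x : Fin 3 → Fin 4 → K) (s : K),
      MvPolynomial.eval (embV w + s • embX x) (perPoly (Fin 4) K) =
        s ^ 3 * (Matrix.of ![w, x 0, x 1, x 2]).permanent) :
    False := by
  classical
  have hDis : (D⁻¹)ᵀ = D⁻¹ := by rw [Matrix.transpose_nonsing_inv, hDs]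
  -- the vector `u(x) = D⁻¹ bL (embX x)` and the form `Θ(x)[y] = u(x)ᵀ CL(embX y) u(x)`
  set f : (Fin 3 → Fin 4 → K) →ₗ[K] (ι' → K) := bL ∘ₗ embX with hfdef
  have hf : ∀ x, f x = bL (embX x) := fun x => rfl
  let u : (Fin 3 → Fin 4 → K) → (ι' → K) := fun x => D⁻¹ *ᵥ bL (embX x)
  have hu : ∀ x, u x = D⁻¹ *ᵥ bL (embX x) := fun x => rfl
  have hDu : ∀ x, D *ᵥ u x = bL (embX x) := fun x => by
    rw [hu, Matrix.mulVec_mulVec, Matrix.mul_nonsing_inv _ hD, Matrix.one_mulVec]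
  let Θ : (Fin 3 → Fin 4 → K) → ((Fin 3 → Fin 4 → K) →ₗ[K] K) := fun x =>
    { toFun := fun y => u x ⬝ᵥ CL (embX y) *ᵥ u x
      map_add' := fun y y' => by
        simp only [map_add, Matrix.add_mulVec, dotProduct_add]
      map_smul' := fun c y => by
        simp only [map_smul, Matrix.smul_mulVec, dotProduct_smul, smul_eq_mul,
          RingHom.id_apply] }
  have hΘ : ∀ x y, Θ x y = u x ⬝ᵥ CL (embX y) *ᵥ u x := fun x y => rfl
  have hΘ0 : ∀ x, u x ⬝ᵥ CL (embX x) *ᵥ u x = 0 := fun x => by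
    have h := hii (embX x)
    rwa [sandwich₂_eq hDis] at h
  -- the linear maps `K(w)`: `bL (embX (K w x)) = CL(embV w) D⁻¹ bL(embX x)`
  have hf_mem : ∀ x, f x ∈ LinearMap.range bL := fun x => ⟨embX x, rfl⟩
  let f' : (Fin 3 → Fin 4 → K) →ₗ[K] LinearMap.range bL := LinearMap.codRestrict _ f hf_mem
  have hf'inj : Function.Injective f' := fun a b h => hEX (congr_arg Subtype.val h)
  have hf'surj : Function.Surjective f' := by
    rintro ⟨y, z, rfl⟩
    obtain ⟨x, hx⟩ := hEXr z
    exact ⟨x, Subtype.ext hx⟩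
  let e : (Fin 3 → Fin 4 → K) ≃ₗ[K] LinearMap.range bL :=
    LinearEquiv.ofBijective f' ⟨hf'inj, hf'surj⟩
  have he : ∀ x, (e x : ι' → K) = bL (embX x) := fun x => rfl
  let g : (Fin 4 → K) → (Fin 3 → Fin 4 → K) →ₗ[K] LinearMap.range bL := fun w =>
    LinearMap.codRestrict _ ((CL (embV w)).mulVecLin ∘ₗ (D⁻¹).mulVecLin ∘ₗ f)
      fun x => hinv w _ (hf_mem x)
  have hg : ∀ w x, (g w x : ι' → K) = CL (embV w) *ᵥ (D⁻¹ *ᵥ bL (embX x)) := fun w x => rfl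
  let Kv : (Fin 4 → K) → (Fin 3 → Fin 4 → K) →ₗ[K] (Fin 3 → Fin 4 → K) := fun w =>
    e.symm.toLinearMap ∘ₗ g w
  have hKv : ∀ w x, bL (embX (Kv w x)) = CL (embV w) *ᵥ u x := by
    intro w x
    have h1 : (e (e.symm (g w x)) : ι' → K) = (g w x : ι' → K) := by rw [e.apply_symm_apply]
    rw [he, hg] at h1
    exact h1
  -- the base-point identity along `t ↦ t · embV w`
  have hmain : ∀ (w : Fin 4 → K) (x : Fin 3 → Fin 4 → K) (t : K),
      (D + t • CL (embV w)).det * (t * Θ x (Kv w x)) =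
        κ * t * (Matrix.of ![w, (x + t • Kv w x) 0, (x + t • Kv w x) 1,
          (x + t • Kv w x) 2]).permanent := by
    intro w x t
    obtain ⟨hNt, hdet⟩ := hN (t • embV w) (by rw [map_smul, hEV, smul_zero])
    have hCt : CL (t • embV w) = t • CL (embV w) := by rw [map_smul]
    set z : Fin 4 × Fin 4 → K := embX (x + t • Kv w x) with hz
    have hbz : bL z = (D + CL (t • embV w)) *ᵥ u x := by
      rw [hz, map_add, map_add, map_smul, map_smul, Matrix.add_mulVec, hDu, hKv, hCt,
        Matrix.smul_mulVec]
    have hNs : (D + CL (t • embV w))ᵀ = D + CL (t • embV w) := by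
      rw [Matrix.transpose_add, hDs, hCs]
    have hE : ∀ s : K, (Matrix.fromBlocks ((s * 0) • (1 : Matrix Unit Unit K))
        (Matrix.replicateRow Unit (s • (D + CL (t • embV w)) *ᵥ u x))
        (Matrix.replicateCol Unit (s • (D + CL (t • embV w)) *ᵥ u x))
        (D + CL (t • embV w) + s • CL z)).det =
        s ^ 3 * (κ * t * (Matrix.of ![w, (x + t • Kv w x) 0, (x + t • Kv w x) 1,
          (x + t • Kv w x) 2]).permanent) + s ^ 4 * 0 := by
      intro s
      rw [← hbz, ← hdet z s, hz, ← map_smul, hper, permanent_rows_smul₀]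
      ring
    obtain ⟨-, -, h3⟩ := basepoint_moment hNt hNs 0 _ 0 (u x) hE
    -- `uᵀ CL(z) u = t Θ(x)[K w x]`
    have hq : u x ⬝ᵥ CL z *ᵥ u x = t * Θ x (Kv w x) := by
      rw [hz, map_add, map_smul, map_add, map_smul, Matrix.add_mulVec, dotProduct_add, hΘ0,
        zero_add, Matrix.smul_mulVec, dotProduct_smul, smul_eq_mul, hΘ]
    rw [hq, hCt] at h3
    rw [h3]
  -- (K0) and (K1) by comparing coefficients in `t`
  have hK01 : ∀ (w : Fin 4 → K) (x : Fin 3 → Fin 4 → K),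
      D.det * Θ x (Kv w x) = κ * (Matrix.of ![w, x 0, x 1, x 2]).permanent ∧
      (D.map Polynomial.C + (Polynomial.X : K[X]) • (CL (embV w)).map Polynomial.C).det.coeff 1 *
          Θ x (Kv w x) =
        κ * ((Matrix.of ![w, Kv w x 0, x 1, x 2]).permanent +
          (Matrix.of ![w, x 0, Kv w x 1, x 2]).permanent +
          (Matrix.of ![w, x 0, x 1, Kv w x 2]).permanent) := by
    intro w x
    set y := Kv w x with hy
    set Θ₀ := Θ x y with hΘ₀
    set F₀ := (Matrix.of ![w, x 0, x 1, x 2]).permanent with hF₀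
    set F₁ := (Matrix.of ![w, y 0, x 1, x 2]).permanent +
      (Matrix.of ![w, x 0, y 1, x 2]).permanent + (Matrix.of ![w, x 0, x 1, y 2]).permanent with hF₁
    set F₂ := (Matrix.of ![w, x 0, y 1, y 2]).permanent +
      (Matrix.of ![w, y 0, x 1, y 2]).permanent + (Matrix.of ![w, y 0, y 1, x 2]).permanent with hF₂
    set F₃ := (Matrix.of ![w, y 0, y 1, y 2]).permanent with hF₃
    set δ : K[X] :=
      (D.map Polynomial.C + (Polynomial.X : K[X]) • (CL (embV w)).map Polynomial.C).det with hδ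
    set Q : K[X] := Polynomial.C Θ₀ * δ - Polynomial.C κ * (Polynomial.C F₀ +
      Polynomial.C F₁ * Polynomial.X + Polynomial.C F₂ * Polynomial.X ^ 2 +
      Polynomial.C F₃ * Polynomial.X ^ 3) with hQ
    have hroot : ∀ t : K, t ≠ 0 → Q.IsRoot t := by
      intro t ht
      have h := hmain w x t
      simp only [Pi.add_apply, Pi.smul_apply] at h
      rw [permanent_rows_add_smul] at h
      rw [Polynomial.IsRoot.def, hQ]
      simp only [Polynomial.eval_sub, Polynomial.eval_mul, Polynomial.eval_C, Polynomial.eval_add,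
        Polynomial.eval_X, Polynomial.eval_pow]
      rw [hδ, eval_detLine]
      have h' : t * (Θ₀ * (D + t • CL (embV w)).det -
          κ * (F₀ + F₁ * t + F₂ * t ^ 2 + F₃ * t ^ 3)) = 0 := by
        rw [hΘ₀, hF₀, hF₁, hF₂, hF₃, hy]
        linear_combination h
      exact (mul_eq_zero.1 h').resolve_left ht
    have hQ0 : Q = 0 := by
      apply Polynomial.eq_zero_of_infinite_isRoot
      refine ((Set.finite_singleton (0 : K)).infinite_compl).mono fun t ht => ?_
      exact hroot t ht
    obtain ⟨c0, c1⟩ := coeff_cubic F₀ F₁ F₂ F₃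
    have e0 : Q.coeff 0 = 0 := by rw [hQ0, Polynomial.coeff_zero]
    have e1 : Q.coeff 1 = 0 := by rw [hQ0, Polynomial.coeff_zero]
    rw [hQ, Polynomial.coeff_sub, Polynomial.coeff_C_mul, Polynomial.coeff_C_mul] at e0 e1
    rw [c0, hδ, coeff_detLine_zero] at e0
    rw [c1] at e1
    constructor
    · linear_combination e0
    · linear_combination e1
  exact false_of_oneRow_identities Θ Kv
    (fun w => (D.map Polynomial.C +
      (Polynomial.X : K[X]) • (CL (embV w)).map Polynomial.C).det.coeff 1)
    hD.ne_zero hκ (fun w x => (hK01 w x).1) (fun w x => (hK01 w x).2)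

end Summit.ValiantsHypothesis.ValiantsHypothesis.Theorems.SymPencilPerFourOneRowKernel

end
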